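import Literature.Analysis.Fourier.HeckeIdentity
import Mathlib
import HarnessLib

/-!
# Hecke's identity with a radial square weight: `∫ ‖x‖² H(x) e^{−b‖x‖²} cos⟪ξ,x⟫ dx`

Differentiating the cosine form of Hecke's identity ✓`Literature.Analysis.Fourier.integral_eval_mul_exp_mul_cos` in the Gaussian parameter
`b` gives the Fourier–cosine transform of `‖x‖² H(x) e^{−b‖x‖²}` for `H` harmonic homogeneous of degree `k` on `ℝⁿ`:

  ★ `integral_sq_norm_mul_eval_mul_exp_mul_cos`:
    `∫ ‖x‖² H(x) e^{−b‖x‖²} cos⟪ξ,x⟫ dx = π^{n/2} Re((−i/2)^k) H(ξ) · b^{−(n/2+k)} e^{−‖ξ‖²/(4b)} · ((n/2+k)/b − ‖ξ‖²/(4b²))`.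

With `Δ(H e^{−b‖x‖²}) = (4b²‖x‖² − 2b(2k+n)) H e^{−b‖x‖²}` this is the ingredient that turns the spatial Laplacian into multiplication by
`−‖ξ‖²` on Gaussian–harmonic probes (the `Δ_z ↔ −|q⃗|²` half of `Δ₄ ↔ E² − |q⃗|²` for Laplace–Fourier measures).  Also recorded:
`integral_eval_mul_exp_mul_cos'`, the cosine identity in the unpacked normalisation `π^{n/2} Re((−i/2)^k) b^{−(n/2+k)}`.
Proof: dominated differentiation under the integral in `b` (`hasDerivAt_integral_of_dominated_loc_of_deriv_le`) and uniqueness of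
derivatives. [cite: SteinWeiss1971, Ch. IV Thm. 3.4]
-/

set_option autoImplicit false

noncomputable section

namespace Literature.Analysis.Fourier

open MvPolynomial _root_.MeasureTheory Filter
open scoped BigOperators RealInnerProductSpace _root_.Topology

variable {n : ℕ}

/-! ## § 1. Private infrastructure -/

/-- The Gaussian `e^{−a‖x‖²}` is integrable on `ℝⁿ` (`a > 0`). [folklore] -/
private theorem integrable_exp_neg_mul_sq_norm₃ {a : ℝ} (ha : 0 < a) :
    Integrable (fun x : EuclideanSpace ℝ (Fin n) => Real.exp (-(a * ‖x‖ ^ 2))) := by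
  refine Integrable.of_integral_ne_zero (fun h => ?_)
  have h1 := GaussianFourier.integral_rexp_neg_mul_sq_norm (V := EuclideanSpace ℝ (Fin n)) ha
  have h2 : (fun v : EuclideanSpace ℝ (Fin n) => Real.exp (-a * ‖v‖ ^ 2)) = fun v => Real.exp (-(a * ‖v‖ ^ 2)) := by
    funext v; ring_nf
  rw [h2, h] at h1
  have : (0 : ℝ) < (Real.pi / a) ^ (Module.finrank ℝ (EuclideanSpace ℝ (Fin n)) / 2 : ℝ) := by positivity
  linarith

/-- Polynomial functions times Gaussians are integrable (private copy). [folklore] -/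
private theorem integrable_eval_mul_exp₃ (P : MvPolynomial (Fin n) ℝ) {a : ℝ} (ha : 0 < a) :
    Integrable (fun x : EuclideanSpace ℝ (Fin n) => eval (WithLp.ofLp x) P * Real.exp (-(a * ‖x‖ ^ 2))) := by
  induction P using MvPolynomial.induction_on generalizing a with
  | C c =>
    simpa using (integrable_exp_neg_mul_sq_norm₃ ha).const_mul c
  | add p q hp hq =>
    refine ((hp ha).add (hq ha)).congr (Filter.Eventually.of_forall fun x => ?_)
    simp only [Pi.add_apply, map_add, add_mul]
  | mul_X p i hp =>
    have ha2 : 0 < a / 2 := by positivity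
    have hmeas : AEStronglyMeasurable (fun x : EuclideanSpace ℝ (Fin n) => x i * Real.exp (-(a / 2 * ‖x‖ ^ 2))) volume := by
      have : Continuous fun x : EuclideanSpace ℝ (Fin n) => x i * Real.exp (-(a / 2 * ‖x‖ ^ 2)) := by fun_prop
      exact this.aestronglyMeasurable
    have hbd : ∀ x : EuclideanSpace ℝ (Fin n), |x i| * Real.exp (-(a / 2 * ‖x‖ ^ 2)) ≤ (1 + 1 / (a / 2)) / 2 := by
      intro x
      have hxi : |x i| ≤ ‖x‖ := by
        have := PiLp.norm_apply_le x i
        rwa [Real.norm_eq_abs] at this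
      have hexp1 : Real.exp (-(a / 2 * ‖x‖ ^ 2)) ≤ 1 := by
        rw [Real.exp_le_one_iff]; nlinarith [norm_nonneg x]
      have hexp2 : a / 2 * ‖x‖ ^ 2 * Real.exp (-(a / 2 * ‖x‖ ^ 2)) ≤ 1 := by
        have h := Real.add_one_le_exp (a / 2 * ‖x‖ ^ 2)
        have hpos : 0 < Real.exp (a / 2 * ‖x‖ ^ 2) := Real.exp_pos _
        rw [Real.exp_neg, mul_inv_le_iff₀ hpos]
        nlinarith [norm_nonneg x]
      have hamgm : ‖x‖ ≤ (1 + ‖x‖ ^ 2) / 2 := by nlinarith [sq_nonneg (‖x‖ - 1)]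
      have he0 : 0 ≤ Real.exp (-(a / 2 * ‖x‖ ^ 2)) := (Real.exp_pos _).le
      calc |x i| * Real.exp (-(a / 2 * ‖x‖ ^ 2))
          ≤ (1 + ‖x‖ ^ 2) / 2 * Real.exp (-(a / 2 * ‖x‖ ^ 2)) := mul_le_mul_of_nonneg_right (hxi.trans hamgm) he0
        _ = (Real.exp (-(a / 2 * ‖x‖ ^ 2)) + (1 / (a / 2)) * (a / 2 * ‖x‖ ^ 2 * Real.exp (-(a / 2 * ‖x‖ ^ 2)))) / 2 := by
            field_simp
        _ ≤ (1 + (1 / (a / 2)) * 1) / 2 := by gcongr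
        _ = (1 + 1 / (a / 2)) / 2 := by ring
    have h := (hp ha2).mul_bdd hmeas (c := (1 + 1 / (a / 2)) / 2)
      (Filter.Eventually.of_forall fun x => by
        rw [Real.norm_eq_abs, abs_mul, abs_of_pos (Real.exp_pos _)]
        exact hbd x)
    refine h.congr (Filter.Eventually.of_forall fun x => ?_)
    simp only [map_mul, eval_X]
    have : Real.exp (-(a * ‖x‖ ^ 2)) = Real.exp (-(a / 2 * ‖x‖ ^ 2)) * Real.exp (-(a / 2 * ‖x‖ ^ 2)) := by
      rw [← Real.exp_add]; ring_nf
    rw [this]; ring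

/-- `Re((−i/(2b))^k) = Re((−i/2)^k) · (b⁻¹)^k` for real `b`. [folklore] -/
private theorem re_pow_div (b : ℝ) (k : ℕ) :
    ((-Complex.I / (2 * (b : ℂ))) ^ k).re = ((-Complex.I / 2) ^ k).re * (b⁻¹) ^ k := by
  have h : (-Complex.I / (2 * (b : ℂ))) = (-Complex.I / 2) * ((b⁻¹ : ℝ) : ℂ) := by
    push_cast; ring
  rw [h, mul_pow, ← Complex.ofReal_pow, Complex.re_mul_ofReal]

/-! ## § 2. The cosine identity in the unpacked normalisation -/

/-- Hecke's cosine identity, unpacked: `∫ H(x) e^{−b‖x‖²} cos⟪ξ,x⟫ dx = π^{n/2} Re((−i/2)^k) H(ξ) · b^{−(n/2+k)} e^{−‖ξ‖²/(4b)}`.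
[cite: SteinWeiss1971, Ch. IV Thm. 3.4] -/
theorem integral_eval_mul_exp_mul_cos' (H : MvPolynomial (Fin n) ℝ) {k : ℕ} (hHk : H.IsHomogeneous k)
    (hH : ∑ i, pderiv i (pderiv i H) = 0) {b : ℝ} (hb : 0 < b) (ξ : EuclideanSpace ℝ (Fin n)) :
    ∫ x : EuclideanSpace ℝ (Fin n), eval (WithLp.ofLp x) H * Real.exp (-(b * ‖x‖ ^ 2)) * Real.cos ⟪ξ, x⟫
      = Real.pi ^ (n / 2 : ℝ) * ((-Complex.I / 2) ^ k).re * eval (WithLp.ofLp ξ) H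
          * (b ^ (-((n : ℝ) / 2 + k)) * Real.exp (-(‖ξ‖ ^ 2 / (4 * b)))) := by
  rw [integral_eval_mul_exp_mul_cos H hHk hH hb ξ, re_pow_div, Real.div_rpow Real.pi_pos.le hb.le]
  have hb' : b ^ (-((n : ℝ) / 2 + k)) = (b ^ ((n : ℝ) / 2))⁻¹ * (b⁻¹) ^ k := by
    rw [Real.rpow_neg hb.le, Real.rpow_add hb, Real.rpow_natCast, mul_inv, inv_pow]
  rw [hb']
  field_simp

/-! ## § 3. The radial square weight -/

/-- ★ **Hecke's identity with the weight `‖x‖²`**: for `H` harmonic homogeneous of degree `k` on `ℝⁿ`, `b > 0`, `ξ ∈ ℝⁿ`,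
`∫ ‖x‖² H(x) e^{−b‖x‖²} cos⟪ξ,x⟫ dx = π^{n/2} Re((−i/2)^k) H(ξ) · b^{−(n/2+k)} e^{−‖ξ‖²/(4b)} · ((n/2+k)/b − ‖ξ‖²/(4b²))`
(derivative of the cosine identity in `b`). [cite: SteinWeiss1971, Ch. IV Thm. 3.4] -/
theorem integral_sq_norm_mul_eval_mul_exp_mul_cos (H : MvPolynomial (Fin n) ℝ) {k : ℕ} (hHk : H.IsHomogeneous k)
    (hH : ∑ i, pderiv i (pderiv i H) = 0) {b₀ : ℝ} (hb₀ : 0 < b₀) (ξ : EuclideanSpace ℝ (Fin n)) :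
    ∫ x : EuclideanSpace ℝ (Fin n), ‖x‖ ^ 2 * eval (WithLp.ofLp x) H * Real.exp (-(b₀ * ‖x‖ ^ 2)) * Real.cos ⟪ξ, x⟫
      = Real.pi ^ (n / 2 : ℝ) * ((-Complex.I / 2) ^ k).re * eval (WithLp.ofLp ξ) H
          * (b₀ ^ (-((n : ℝ) / 2 + k)) * Real.exp (-(‖ξ‖ ^ 2 / (4 * b₀))))
          * (((n : ℝ) / 2 + k) / b₀ - ‖ξ‖ ^ 2 / (4 * b₀ ^ 2)) := by
  -- the two functions of `b`
  set F : ℝ → ℝ := fun b => ∫ x : EuclideanSpace ℝ (Fin n),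
      eval (WithLp.ofLp x) H * Real.exp (-(b * ‖x‖ ^ 2)) * Real.cos ⟪ξ, x⟫ with hF
  set A : ℝ := Real.pi ^ (n / 2 : ℝ) * ((-Complex.I / 2) ^ k).re * eval (WithLp.ofLp ξ) H with hA
  set p : ℝ := (n : ℝ) / 2 + k with hp
  set c : ℝ := ‖ξ‖ ^ 2 / 4 with hc
  set g : ℝ → ℝ := fun b => b ^ (-p) * Real.exp (-(c * b⁻¹)) with hg
  -- (1) `F = A · g` on `(0, ∞)`
  have hFG : ∀ b : ℝ, 0 < b → F b = A * g b := by
    intro b hb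
    have h := integral_eval_mul_exp_mul_cos' H hHk hH hb ξ
    have hcb : -(c * b⁻¹) = -(‖ξ‖ ^ 2 / (4 * b)) := by
      rw [hc]; field_simp
    simp only [hF, hg, hA, hp, hcb]
    rw [h]
  -- (2) derivative of `g` at `b₀`
  have hg' : HasDerivAt g (g b₀ * (-p / b₀ + c / b₀ ^ 2)) b₀ := by
    have h1 : HasDerivAt (fun b : ℝ => b ^ (-p)) (-p * b₀ ^ (-p - 1)) b₀ :=
      Real.hasDerivAt_rpow_const (Or.inl hb₀.ne')
    have h2 : HasDerivAt (fun b : ℝ => Real.exp (-(c * b⁻¹))) (Real.exp (-(c * b₀⁻¹)) * (-(c * -(b₀ ^ 2)⁻¹))) b₀ :=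
      (((hasDerivAt_inv hb₀.ne').const_mul c).neg).exp
    have h := h1.mul h2
    refine h.congr_deriv ?_
    rw [hg]
    simp only []
    rw [Real.rpow_sub_one hb₀.ne']
    field_simp
  -- (3) derivative of `F` at `b₀` by dominated differentiation
  have hF' : HasDerivAt F (-∫ x : EuclideanSpace ℝ (Fin n),
      ‖x‖ ^ 2 * eval (WithLp.ofLp x) H * Real.exp (-(b₀ * ‖x‖ ^ 2)) * Real.cos ⟪ξ, x⟫) b₀ := by
    -- the polynomial `‖x‖² H`
    set Q : MvPolynomial (Fin n) ℝ := (∑ i, X i ^ 2) * H with hQ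
    have hQeval : ∀ x : EuclideanSpace ℝ (Fin n), eval (WithLp.ofLp x) Q = ‖x‖ ^ 2 * eval (WithLp.ofLp x) H := by
      intro x
      rw [hQ, map_mul, map_sum, EuclideanSpace.real_norm_sq_eq]
      simp [map_pow, eval_X]
    have hmeas : ∀ b : ℝ, AEStronglyMeasurable (fun x : EuclideanSpace ℝ (Fin n) =>
        eval (WithLp.ofLp x) H * Real.exp (-(b * ‖x‖ ^ 2)) * Real.cos ⟪ξ, x⟫) volume := by
      intro b
      have : Continuous fun x : EuclideanSpace ℝ (Fin n) =>
          eval (WithLp.ofLp x) H * Real.exp (-(b * ‖x‖ ^ 2)) * Real.cos ⟪ξ, x⟫ :=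
        (((Literature.Topology.FourManifolds.contDiff_mvPolynomial_eval_ofLp H (N := 0)).continuous).mul
          (by fun_prop)).mul (by fun_prop)
      exact this.aestronglyMeasurable
    have hint : ∀ b : ℝ, 0 < b → Integrable (fun x : EuclideanSpace ℝ (Fin n) =>
        eval (WithLp.ofLp x) H * Real.exp (-(b * ‖x‖ ^ 2)) * Real.cos ⟪ξ, x⟫) := by
      intro b hb
      refine ((integrable_eval_mul_exp₃ H hb).norm).mono' (hmeas b) (Filter.Eventually.of_forall fun x => ?_)
      rw [Real.norm_eq_abs, Real.norm_eq_abs, abs_mul]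
      exact mul_le_of_le_one_right (abs_nonneg _) (Real.abs_cos_le_one _)
    have hmeas' : AEStronglyMeasurable (fun x : EuclideanSpace ℝ (Fin n) =>
        -(‖x‖ ^ 2 * eval (WithLp.ofLp x) H * Real.exp (-(b₀ * ‖x‖ ^ 2)) * Real.cos ⟪ξ, x⟫)) volume := by
      have : Continuous fun x : EuclideanSpace ℝ (Fin n) =>
          -(‖x‖ ^ 2 * eval (WithLp.ofLp x) H * Real.exp (-(b₀ * ‖x‖ ^ 2)) * Real.cos ⟪ξ, x⟫) :=
        ((((by fun_prop : Continuous fun x : EuclideanSpace ℝ (Fin n) => ‖x‖ ^ 2).mul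
          (Literature.Topology.FourManifolds.contDiff_mvPolynomial_eval_ofLp H (N := 0)).continuous).mul
          (by fun_prop)).mul (by fun_prop)).neg
      exact this.aestronglyMeasurable
    have hbound : Integrable (fun x : EuclideanSpace ℝ (Fin n) =>
        |eval (WithLp.ofLp x) Q| * Real.exp (-(b₀ / 2 * ‖x‖ ^ 2))) := by
      refine ((integrable_eval_mul_exp₃ Q (half_pos hb₀)).norm).congr (Filter.Eventually.of_forall fun x => ?_)
      simp only [Real.norm_eq_abs, abs_mul, abs_of_pos (Real.exp_pos _)]
    have key := hasDerivAt_integral_of_dominated_loc_of_deriv_le (μ := (volume : Measure (EuclideanSpace ℝ (Fin n))))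
      (x₀ := b₀) (s := Set.Ioi (b₀ / 2))
      (F := fun (b : ℝ) (x : EuclideanSpace ℝ (Fin n)) => eval (WithLp.ofLp x) H * Real.exp (-(b * ‖x‖ ^ 2)) * Real.cos ⟪ξ, x⟫)
      (F' := fun (b : ℝ) (x : EuclideanSpace ℝ (Fin n)) =>
        -(‖x‖ ^ 2 * eval (WithLp.ofLp x) H * Real.exp (-(b * ‖x‖ ^ 2)) * Real.cos ⟪ξ, x⟫))
      (bound := fun x => |eval (WithLp.ofLp x) Q| * Real.exp (-(b₀ / 2 * ‖x‖ ^ 2)))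
      (Ioi_mem_nhds (by linarith)) (Filter.Eventually.of_forall hmeas) (hint b₀ hb₀) hmeas' ?_ hbound ?_
    · rw [hF]
      simpa [integral_neg] using key.2
    · refine Filter.Eventually.of_forall fun x b hb => ?_
      have hb' : b₀ / 2 < b := hb
      have hcos : |Real.cos ⟪ξ, x⟫| ≤ 1 := Real.abs_cos_le_one _
      have hexp : Real.exp (-(b * ‖x‖ ^ 2)) ≤ Real.exp (-(b₀ / 2 * ‖x‖ ^ 2)) :=
        Real.exp_le_exp.mpr (by nlinarith [sq_nonneg ‖x‖])
      calc ‖-(‖x‖ ^ 2 * eval (WithLp.ofLp x) H * Real.exp (-(b * ‖x‖ ^ 2)) * Real.cos ⟪ξ, x⟫)‖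
          = |‖x‖ ^ 2 * eval (WithLp.ofLp x) H| * Real.exp (-(b * ‖x‖ ^ 2)) * |Real.cos ⟪ξ, x⟫| := by
            rw [norm_neg, Real.norm_eq_abs, abs_mul, abs_mul, abs_of_pos (Real.exp_pos _)]
        _ ≤ |‖x‖ ^ 2 * eval (WithLp.ofLp x) H| * Real.exp (-(b₀ / 2 * ‖x‖ ^ 2)) * 1 := by
            gcongr
        _ = |eval (WithLp.ofLp x) Q| * Real.exp (-(b₀ / 2 * ‖x‖ ^ 2)) := by
            rw [hQeval, mul_one]
    · refine Filter.Eventually.of_forall fun x b _ => ?_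
      have h1 : HasDerivAt (fun b : ℝ => -(b * ‖x‖ ^ 2)) (-(1 * ‖x‖ ^ 2)) b := ((hasDerivAt_id b).mul_const _).neg
      have h2 : HasDerivAt (fun b : ℝ => eval (WithLp.ofLp x) H * Real.exp (-(b * ‖x‖ ^ 2)) * Real.cos ⟪ξ, x⟫)
          (eval (WithLp.ofLp x) H * (Real.exp (-(b * ‖x‖ ^ 2)) * -(1 * ‖x‖ ^ 2)) * Real.cos ⟪ξ, x⟫) b :=
        (h1.exp.const_mul _).mul_const _
      refine h2.congr_deriv ?_
      ring
  -- (4) uniqueness of the derivative of `F = A · g` near `b₀`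
  have hFG' : HasDerivAt F (A * (g b₀ * (-p / b₀ + c / b₀ ^ 2))) b₀ := by
    have h := hg'.const_mul A
    refine h.congr_of_eventuallyEq ?_
    filter_upwards [Ioi_mem_nhds hb₀] with b hb
    exact hFG b hb
  have huniq := hF'.unique hFG'
  -- conclude
  have : ∫ x : EuclideanSpace ℝ (Fin n), ‖x‖ ^ 2 * eval (WithLp.ofLp x) H * Real.exp (-(b₀ * ‖x‖ ^ 2)) * Real.cos ⟪ξ, x⟫
      = -(A * (g b₀ * (-p / b₀ + c / b₀ ^ 2))) := by linarith
  rw [this, hA, hg, hp, hc]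
  simp only []
  rw [show -(c * b₀⁻¹) = -(‖ξ‖ ^ 2 / (4 * b₀)) by rw [hc]; field_simp]
  field_simp
  ring

end Literature.Analysis.Fourier

end
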